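import Mathlib
import HarnessLib
import Summits.ValiantsHypothesis.ValiantsHypothesis.Theorems.LacunarySymmetroidMatrixDescartesProductPlusOneSharpKSignAware
import Summits.ValiantsHypothesis.ValiantsHypothesis.Theorems.LacunarySymmetroidMatrixDescartesProductPlusOneMixedSector

/-!
# ValiantsHypothesis / LacunarySymmetroid — crux `MatrixDescartes` (stmt-ValiantsHypothesis-18050, V1),
# LINE (A) «product_plus_one»: the GAP-PARITY LEMMA and the MIXED SECTOR SIGN-AWARE (`Z₊ ≤ 2m + 2`)

`card_pos_roots_le_countP_add_two` (GAP PARITY, abstract): for `h = κ X^N + P` (`κ ≠ 0`, `P ≠ 0`), if no zero-free interval of `P`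
carries three positive zeros of `h`, then `Z₊(h) ≤ #{positive zeros of P, with multiplicity} + 2` — because `P = −κ x^N` has a fixed sign
on the zeros of `h`, so between consecutive zeros of `h` the zeros of `P` have even multiplicity (`two_le_countP_Ioo_of_same_sign`, ✓
`…SharpKSignAware`).  Applied to the K = 3 MIXED sector (✓ `…MixedSector`: ratio ∈ [2,4], every factor no-dip or sharp dip, bottom
coupling; «no three zeros» by Rolle + `psi_injective_mixed`; multiplicity ≤ 2 per trinomial factor by Descartes): `mixed_sector_pos_roots_signed`
/ `mixed_sector_class_signed` — `Z₊ ≤ 2m + 2` (was `4m + 2`); for all-no-dip members this is ≤ 2m + 2 as well (p5's `…TameSigned` has the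
sharper `m + 2` there, using multiplicity 1 per no-dip factor — recovered here as `tame_sector_pos_roots_signed'`).

HONEST FRAMING: sector constants; NOT `stub_classRowK3`, not `stub_polyLaw`, not `ProductPlusOneMDR`, not `MatrixDescartes`, not
Conjecture B; `VP ≠ VNP` is NOT proved.  No definitions, no named facts.
-/

-- `Summit.ValiantsHypothesis.ValiantsHypothesis.…` is the tree's mandated single-conjunct layout (Sub = Summit).
set_option linter.dupNamespace false

namespace Summit.ValiantsHypothesis.ValiantsHypothesis.Theorems.LacunarySymmetroidMatrixDescartes

namespace ProductPlusOne

open Polynomial Finset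
open scoped BigOperators

/-- **GAP PARITY**: `h = κ X^N + P`, `κ ≠ 0`, `P ≠ 0`; if no zero-free closed interval of `P` contains three positive zeros of `h`,
then `Z₊(h) ≤ #{positive zeros of P counted with multiplicity} + 2`. [this file's theorem] -/
theorem card_pos_roots_le_countP_add_two (P : ℝ[X]) (hP0 : P ≠ 0) (κ : ℝ) (hκ : κ ≠ 0) (N : ℕ)
    (hthree : ∀ z₁ ∈ (C κ * X ^ N + P).roots.toFinset.filter (fun t => 0 < t),
      ∀ z₂ ∈ (C κ * X ^ N + P).roots.toFinset.filter (fun t => 0 < t),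
      ∀ z₃ ∈ (C κ * X ^ N + P).roots.toFinset.filter (fun t => 0 < t),
      z₁ < z₂ → z₂ < z₃ → (∀ t ∈ Set.Icc z₁ z₃, P.eval t ≠ 0) → False) :
    ((C κ * X ^ N + P).roots.toFinset.filter (fun t => 0 < t)).card ≤ P.roots.countP (fun t => 0 < t) + 2 := by
  classical
  set S := (C κ * X ^ N + P).roots.toFinset.filter (fun t => 0 < t) with hSdef
  have hSmem : ∀ z ∈ S, 0 < z ∧ eval z (C κ * X ^ N + P) = 0 := by
    intro z hz
    rw [hSdef, mem_filter, Multiset.mem_toFinset] at hz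
    by_cases h0 : C κ * X ^ N + P = 0
    · rw [h0, roots_zero] at hz
      exact absurd hz.1 (Multiset.notMem_zero _)
    · exact ⟨hz.2, (IsRoot.def).mp ((mem_roots h0).mp hz.1)⟩
  have hPS : ∀ z ∈ S, eval z P = -κ * z ^ N := by
    intro z hz
    have h := (hSmem z hz).2
    rw [eval_add, eval_mul, eval_C, eval_pow, eval_X] at h
    linarith
  have hPne : ∀ z ∈ S, eval z P ≠ 0 := by
    intro z hz
    rw [hPS z hz]
    exact mul_ne_zero (neg_ne_zero.mpr hκ) (pow_ne_zero _ (hSmem z hz).1.ne')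
  have hsame : ∀ z ∈ S, ∀ z' ∈ S, 0 < eval z P * eval z' P := by
    intro z hz z' hz'
    rw [hPS z hz, hPS z' hz']
    have : -κ * z ^ N * (-κ * z' ^ N) = κ ^ 2 * (z * z') ^ N := by ring
    rw [this]
    exact mul_pos (by positivity) (pow_pos (mul_pos (hSmem z hz).1 (hSmem z' hz').1) _)
  have hgap : ∀ a ∈ S, ∀ b ∈ S, a < b → (∃ t ∈ Set.Ioo a b, eval t P = 0) →
      2 ≤ P.roots.countP (fun t => a < t ∧ t < b) :=
    fun a ha b hb hab hroot => two_le_countP_Ioo_of_same_sign P hab (hsame a ha b hb) hroot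
  have hpair : ∀ a ∈ S, ∀ b ∈ S, ∀ e ∈ S, a < b → b < e →
      2 ≤ P.roots.countP (fun t => a < t ∧ t < b) + P.roots.countP (fun t => b < t ∧ t < e) := by
    intro a ha b hb e he hab hbe
    by_cases h1 : ∃ t ∈ Set.Ioo a b, eval t P = 0
    · have := hgap a ha b hb hab h1; omega
    by_cases h2 : ∃ t ∈ Set.Ioo b e, eval t P = 0
    · have := hgap b hb e he hbe h2; omega
    exfalso
    push Not at h1 h2
    refine hthree a ha b hb e he hab hbe (fun t ht hPt => ?_)
    rcases eq_or_lt_of_le ht.1 with h | h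
    · exact hPne a ha (h ▸ hPt)
    rcases lt_trichotomy t b with hb' | hb' | hb'
    · exact h1 t ⟨h, hb'⟩ hPt
    · exact hPne b hb (hb' ▸ hPt)
    rcases eq_or_lt_of_le ht.2 with h' | h'
    · exact hPne e he (h' ▸ hPt)
    · exact h2 t ⟨hb', h'⟩ hPt
  have hadd : ∀ a ∈ S, ∀ b ∈ S, a < b →
      P.roots.countP (fun t => 0 < t ∧ t < b) = P.roots.countP (fun t => 0 < t ∧ t < a) + P.roots.countP (fun t => a < t ∧ t < b) := by
    intro a ha b hb hab
    have ha0 := (hSmem a ha).1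
    rw [Multiset.countP_eq_countP_filter_add P.roots (fun t => 0 < t ∧ t < b) (fun t => t < a), Multiset.countP_filter,
      Multiset.countP_filter]
    congr 1
    · refine Multiset.countP_congr rfl (fun t _ => ?_)
      simp only [eq_iff_iff]
      constructor
      · rintro ⟨⟨h1, _⟩, h3⟩; exact ⟨h1, h3⟩
      · rintro ⟨h1, h3⟩; exact ⟨⟨h1, h3.trans hab⟩, h3⟩
    · refine Multiset.countP_congr rfl (fun t ht => ?_)
      have hta : t ≠ a := fun h => hPne a ha (by rw [← h]; exact (mem_roots hP0).mp ht)
      simp only [not_lt, eq_iff_iff]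
      constructor
      · rintro ⟨⟨_, h2⟩, h3⟩; exact ⟨lt_of_le_of_ne h3 (Ne.symm hta), h2⟩
      · rintro ⟨h1, h2⟩; exact ⟨⟨ha0.trans h1, h2⟩, h1.le⟩
  set s := S.card with hs
  set e : Fin s ↪o ℝ := S.orderEmbOfFin hs.symm with hedef
  have hemem : ∀ i, e i ∈ S := fun i => Finset.orderEmbOfFin_mem S hs.symm i
  have helt : ∀ i j : Fin s, i.val < j.val → e i < e j := fun i j h => e.lt_iff_lt.mpr h
  have hind : ∀ n : ℕ, ∀ h : 2 * n < s, 2 * n ≤ P.roots.countP (fun t => 0 < t ∧ t < e ⟨2 * n, h⟩) := by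
    intro n
    induction n with
    | zero => intro h; exact Nat.zero_le _
    | succ n ih =>
      intro h
      have h0 : 2 * n < s := by omega
      have h1 : 2 * n + 1 < s := by omega
      have ha := hemem ⟨2 * n, h0⟩
      have hb := hemem ⟨2 * n + 1, h1⟩
      have hc' := hemem ⟨2 * (n + 1), h⟩
      have hab : e ⟨2 * n, h0⟩ < e ⟨2 * n + 1, h1⟩ := helt _ _ (by simp)
      have hbc : e ⟨2 * n + 1, h1⟩ < e ⟨2 * (n + 1), h⟩ := helt _ _ (by simp; omega)
      have := ih h0
      rw [hadd _ hb _ hc' hbc, hadd _ ha _ hb hab]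
      have hp := hpair _ ha _ hb _ hc' hab hbc
      omega
  by_contra hcon
  push Not at hcon
  set n := (s - 1) / 2 with hn
  have h2n : 2 * n < s := by omega
  have hle := hind n h2n
  have hbound : P.roots.countP (fun t => 0 < t ∧ t < e ⟨2 * n, h2n⟩) ≤ P.roots.countP (fun t => 0 < t) := by
    rw [Multiset.countP_eq_card_filter, Multiset.countP_eq_card_filter]
    exact Multiset.card_le_card (Multiset.monotone_filter_right _ (fun t ht => ht.1))
  omega

/-- Positive zeros WITH multiplicity of a trinomial `a + bX^{e+1} + cX^{e+k+2}` with `a ≠ 0`: at most `2`. [folklore] -/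
theorem countP_pos_roots_trinomial_le_two (a b c : ℝ) (e k : ℕ) (ha : a ≠ 0) :
    (C a + C b * X ^ (e + 1) + C c * X ^ (e + k + 2) : ℝ[X]).roots.countP (fun t => 0 < t) ≤ 2 := by
  classical
  -- normalise the sign of `a`
  have key : ∀ a' b' c' : ℝ, 0 < a' →
      (C a' + C b' * X ^ (e + 1) + C c' * X ^ (e + k + 2) : ℝ[X]).roots.countP (fun t => 0 < t) ≤ 2 := by
    intro a' b' c' ha'
    refine (roots_countP_pos_le_signVariations _).trans ?_
    rcases le_or_gt 0 c' with hc' | hc'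
    · -- nonneg except possibly the middle index
      exact signVariations_le_two_of_coeff_nonneg_off _ _ (e + 1) le_rfl (fun i hi => by
        rw [coeff_trinomial, if_neg hi]; split_ifs <;> linarith)
    · rcases le_or_gt 0 b' with hb' | hb'
      · -- (+, +, −): nonneg except the top index
        exact (signVariations_le_one_of_top _ (e + k + 2) (fun i hi => by
          rw [coeff_trinomial, if_neg hi]; split_ifs <;> linarith) (fun i hi => by
          rw [coeff_trinomial, if_neg (by omega), if_neg (by omega), if_neg (by omega)]; ring)).trans one_le_two
      · -- (+, −, −): negate ⇒ (−, +, +)… use V(−Q) = V(Q) and nonneg except the bottom index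
        rw [← signVariations_neg]
        have e1 : -(C a' + C b' * X ^ (e + 1) + C c' * X ^ (e + k + 2) : ℝ[X])
            = C (-a') + C (-b') * X ^ (e + 1) + C (-c') * X ^ (e + k + 2) := by
          simp only [map_neg]; ring
        rw [e1]
        exact (signVariations_le_one_of_bottom _ _ 0 le_rfl (fun i hi => by
          rw [coeff_trinomial, if_neg hi]; split_ifs <;> linarith) (fun i hi => absurd hi (Nat.not_lt_zero _))).trans
          one_le_two
  rcases lt_or_gt_of_ne ha with h | h
  · have e1 : (C a + C b * X ^ (e + 1) + C c * X ^ (e + k + 2) : ℝ[X])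
        = -(C (-a) + C (-b) * X ^ (e + 1) + C (-c) * X ^ (e + k + 2)) := by
      simp only [map_neg]; ring
    rw [e1, roots_neg]
    exact key (-a) (-b) (-c) (by linarith)
  · exact key a b c h

/-- **THE MIXED SECTOR, SIGN-AWARE**: ratio ∈ [2,4] (`e ≤ k ≤ 3e+2`), every factor no-dip or sharp dip, bottom coupling ⇒
`Z₊(κ + ∏_j g_j) ≤ 2m + 2`. [this file's theorem] -/
theorem mixed_sector_pos_roots_signed {m : ℕ} (a b c : Fin m → ℝ) (e k : ℕ) (hke : e ≤ k) (hk : k ≤ 3 * e + 2)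
    (hfac : ∀ j, a j * c j < 0 ∨ (0 < a j ∧ 0 < c j ∧ ∃ x₀ : ℝ, 0 < x₀ ∧ a j + b j * x₀ ^ (e + 1) + c j * x₀ ^ (e + k + 2) < 0))
    (κ : ℝ) :
    ((C κ + ∏ j, (C (a j) + C (b j) * X ^ (e + 1) + C (c j) * X ^ (e + k + 2))).roots.toFinset.filter
      (fun t => 0 < t)).card ≤ 2 * m + 2 := by
  classical
  set P : ℝ[X] := ∏ j, (C (a j) + C (b j) * X ^ (e + 1) + C (c j) * X ^ (e + k + 2)) with hPdef
  have ha0 : ∀ j, a j ≠ 0 := by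
    intro j
    rcases hfac j with h | ⟨h, _⟩
    · exact fun h0 => by rw [h0, zero_mul] at h; exact lt_irrefl 0 h
    · exact h.ne'
  rcases Nat.eq_zero_or_pos m with hm | hm
  · subst hm
    have hP1 : P = 1 := by rw [hPdef]; exact Fintype.prod_empty _
    rw [hP1, ← C_1, ← C_add]
    by_cases h0 : κ + 1 = 0
    · rw [h0, map_zero, roots_zero]; simp
    · rw [roots_C]; simp
  have hP0 : P ≠ 0 := prod_trinomial_ne_zero_mixed a b c e k hfac
  -- multiplicity of positive zeros of P ≤ 2m
  have hmult : P.roots.countP (fun t => 0 < t) ≤ 2 * m := by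
    have key : ∀ s : Finset (Fin m),
        (∏ j ∈ s, (C (a j) + C (b j) * X ^ (e + 1) + C (c j) * X ^ (e + k + 2) : ℝ[X])).roots.countP (fun t => 0 < t)
          ≤ 2 * s.card := by
      intro s
      induction s using Finset.induction_on with
      | empty => simp
      | @insert i s hi ih =>
        have hne : ∀ j, (C (a j) + C (b j) * X ^ (e + 1) + C (c j) * X ^ (e + k + 2) : ℝ[X]) ≠ 0 := by
          intro j
          rcases hfac j with h | ⟨h, _, _⟩
          · exact trinomial_ne_zero _ _ _ e k h
          · exact trinomial_ne_zero_of_pos _ _ _ e k h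
        rw [Finset.prod_insert hi, roots_mul (mul_ne_zero (hne i) (Finset.prod_ne_zero_iff.mpr (fun j _ => hne j))),
          Multiset.countP_add, Finset.card_insert_of_notMem hi]
        have h1 := countP_pos_roots_trinomial_le_two (a i) (b i) (c i) e k (ha0 i)
        omega
    have := key Finset.univ
    rwa [Finset.card_univ, Fintype.card_fin] at this
  by_cases hκ : κ = 0
  · -- κ = 0: Z₊(P) ≤ countP ≤ 2m
    subst hκ
    rw [map_zero, zero_add]
    exact ((StubVLawTwo.card_filter_pos_le_countP P).trans hmult).trans (by omega)
  -- no three zeros of κ + P in a zero-free interval of P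
  have hmain := card_pos_roots_le_countP_add_two P hP0 κ hκ 0 ?_
  · rw [pow_zero, mul_one] at hmain
    exact hmain.trans (by omega)
  intro z₁ hz₁ z₂ hz₂ z₃ hz₃ h12 h23 free13
  rw [pow_zero, mul_one] at hz₁ hz₂ hz₃
  have hSmem : ∀ z ∈ (C κ + P).roots.toFinset.filter (fun t => 0 < t), 0 < z ∧ eval z (C κ + P) = 0 := by
    intro z hz
    rw [mem_filter, Multiset.mem_toFinset] at hz
    by_cases h0 : C κ + P = 0
    · rw [h0, roots_zero] at hz
      exact absurd hz.1 (Multiset.notMem_zero _)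
    · exact ⟨hz.2, (IsRoot.def).mp ((mem_roots h0).mp hz.1)⟩
  have hfacne : ∀ t, eval t P ≠ 0 → ∀ j, a j + b j * t ^ (e + 1) + c j * t ^ (e + k + 2) ≠ 0 := by
    intro t ht j hj
    apply ht
    rw [hPdef, eval_prod, Finset.prod_eq_zero_iff]
    exact ⟨j, mem_univ _, by rw [eval_trinomial]; exact hj⟩
  have hz₁pos := (hSmem z₁ hz₁).1
  obtain ⟨w₁, hw₁, hd₁⟩ := exists_deriv_root_between a b c e k κ h12 (hSmem z₁ hz₁).2 (hSmem z₂ hz₂).2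
  obtain ⟨w₂, hw₂, hd₂⟩ := exists_deriv_root_between a b c e k κ h23 (hSmem z₂ hz₂).2 (hSmem z₃ hz₃).2
  have hw₁pos : 0 < w₁ := hz₁pos.trans hw₁.1
  have hw₁₂ : w₁ < w₂ := hw₁.2.trans hw₂.1
  have hIcc : Set.Icc w₁ w₂ ⊆ Set.Icc z₁ z₃ := fun t ht => ⟨hw₁.1.le.trans ht.1, ht.2.trans hw₂.2.le⟩
  have hΨzero : ∀ w : ℝ, 0 < w → (∀ j, a j + b j * w ^ (e + 1) + c j * w ^ (e + k + 2) ≠ 0) →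
      eval w (derivative P) = 0 →
      (∑ j, ((e + 1 : ℝ) * b j + (e + k + 2 : ℝ) * c j * w ^ (k + 1))
          / (a j + b j * w ^ (e + 1) + c j * w ^ (e + k + 2))) = 0 := by
    intro w hw hg hd
    rw [hPdef, eval_derivative_prod a b c e k hg] at hd
    rcases mul_eq_zero.mp hd with h | h
    · rcases mul_eq_zero.mp h with h' | h'
      · exact absurd h' (Finset.prod_ne_zero_iff.mpr (fun j _ => hg j))
      · exact absurd h' (pow_ne_zero _ hw.ne')
    · exact h
  have hg₁ := hfacne w₁ (free13 w₁ (hIcc ⟨le_rfl, hw₁₂.le⟩))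
  have hg₂ := hfacne w₂ (free13 w₂ (hIcc ⟨hw₁₂.le, le_rfl⟩))
  have hΨ₁ := hΨzero w₁ hw₁pos hg₁ (by rw [hPdef]; exact hd₁)
  have hΨ₂ := hΨzero w₂ (hw₁pos.trans hw₁₂) hg₂ (by rw [hPdef]; exact hd₂)
  exact psi_injective_mixed hm a b c e k hke hk hfac hw₁pos hw₁₂ (fun t ht => hfacne t (free13 t (hIcc ht)))
    (hΨ₁.trans hΨ₂.symm)

/-- **THE MIXED SECTOR OF THE `K = 3` ROW, SIGN-AWARE, line shape** (bottom coupling): supports `d 0 < d 1 < d 2` with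
`2(d 1 − d 0) ≤ d 2 − d 0 ≤ 4(d 1 − d 0)`, every factor no-dip or sharp dip ⇒ `Z₊ ≤ 2m + 2`. [this file's theorem] -/
theorem mixed_sector_class_signed {m : ℕ} (d : Fin 3 → ℕ) (h01 : d 0 < d 1) (h12 : d 1 < d 2)
    (h2 : 2 * (d 1 - d 0) ≤ d 2 - d 0) (h4 : d 2 - d 0 ≤ 4 * (d 1 - d 0)) (a : Fin m → Fin 3 → ℝ)
    (hfac : ∀ j, a j 0 * a j 2 < 0 ∨
      (0 < a j 0 ∧ 0 < a j 2 ∧ ∃ x₀ : ℝ, 0 < x₀ ∧ a j 0 * x₀ ^ (d 0) + a j 1 * x₀ ^ (d 1) + a j 2 * x₀ ^ (d 2) < 0)) (c : ℝ) :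
    ((C c * X ^ (m * d 0) + ∏ j, ∑ l, C (a j l) * X ^ (d l) : ℝ[X]).roots.toFinset.filter (fun t => 0 < t)).card
      ≤ 2 * m + 2 := by
  classical
  obtain ⟨e, he⟩ : ∃ e, d 1 = d 0 + e + 1 := ⟨d 1 - d 0 - 1, by omega⟩
  obtain ⟨k, hk⟩ : ∃ k, d 2 = d 0 + e + k + 2 := ⟨d 2 - d 1 - 1, by omega⟩
  have hke : e ≤ k := by omega
  have hk3 : k ≤ 3 * e + 2 := by omega
  have hfac' : ∀ j, a j 0 * a j 2 < 0 ∨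
      (0 < a j 0 ∧ 0 < a j 2 ∧ ∃ x₀ : ℝ, 0 < x₀ ∧ a j 0 + a j 1 * x₀ ^ (e + 1) + a j 2 * x₀ ^ (e + k + 2) < 0) := by
    intro j
    rcases hfac j with h | ⟨ha, hc, x₀, hx₀, hneg⟩
    · exact Or.inl h
    · refine Or.inr ⟨ha, hc, x₀, hx₀, ?_⟩
      have hxd : 0 < x₀ ^ (d 0) := pow_pos hx₀ _
      have e1 : a j 0 * x₀ ^ (d 0) + a j 1 * x₀ ^ (d 1) + a j 2 * x₀ ^ (d 2)
          = x₀ ^ (d 0) * (a j 0 + a j 1 * x₀ ^ (e + 1) + a j 2 * x₀ ^ (e + k + 2)) := by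
        rw [he, hk]; ring
      rw [e1] at hneg
      by_contra hcon
      push Not at hcon
      exact absurd hneg (not_lt.mpr (mul_nonneg hxd.le hcon))
  have hfacx : ∀ j, (∑ l, C (a j l) * X ^ (d l) : ℝ[X])
      = X ^ (d 0) * (C (a j 0) + C (a j 1) * X ^ (e + 1) + C (a j 2) * X ^ (e + k + 2)) := by
    intro j
    rw [Fin.sum_univ_three, he, hk]
    ring
  have hmem : (C c * X ^ (m * d 0) + ∏ j, ∑ l, C (a j l) * X ^ (d l) : ℝ[X])
      = X ^ (m * d 0) * (C c + ∏ j, (C (a j 0) + C (a j 1) * X ^ (e + 1) + C (a j 2) * X ^ (e + k + 2))) := by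
    rw [Finset.prod_congr rfl (fun j _ => hfacx j), Finset.prod_mul_distrib, Finset.prod_const, Finset.card_univ,
      Fintype.card_fin, ← pow_mul, mul_comm (d 0) m]
    ring
  rw [hmem]
  by_cases h0 : (X ^ (m * d 0) * (C c + ∏ j, (C (a j 0) + C (a j 1) * X ^ (e + 1) + C (a j 2) * X ^ (e + k + 2)))
      : ℝ[X]) = 0
  · rw [h0, roots_zero, Multiset.toFinset_zero, Finset.filter_empty, Finset.card_empty]
    exact Nat.zero_le _
  · rw [roots_mul h0, roots_pow, roots_X, Multiset.toFinset_add, Finset.filter_union]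
    refine (Finset.card_union_le _ _).trans ?_
    have hz : (((m * d 0) • ({0} : Multiset ℝ)).toFinset.filter (fun t => 0 < t)) = ∅ := by
      rw [Finset.filter_eq_empty_iff]
      intro t ht
      rw [Multiset.mem_toFinset] at ht
      have h00 := Multiset.mem_singleton.mp (Multiset.mem_of_mem_nsmul ht)
      rw [h00]
      exact lt_irrefl 0
    rw [hz, Finset.card_empty, zero_add]
    exact mixed_sector_pos_roots_signed (fun j => a j 0) (fun j => a j 1) (fun j => a j 2) e k hke hk3 hfac' c

end ProductPlusOne

end Summit.ValiantsHypothesis.ValiantsHypothesis.Theorems.LacunarySymmetroidMatrixDescartes
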